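import Literature.NumberTheory.LFunctions.LagariasDifferencedXi
import Literature.NumberTheory.LFunctions.LagariasDifferencedXiSpacings
import Literature.NumberTheory.LFunctions.LagariasXiPositivityEq14Proofs
import HarnessLib

/-!
# Proof of Lagarias 2005, Theorem 2.1 (zeros of `A_{h,θ}`, `B_{h,θ}` on the line, simple, interlacing) and Lemma 6.1 (ii)

LINE 1 — LABEL: RH-FREE (Theorem 2.1 (1)); Theorem 2.1 (2) and Lemma 6.1 (ii) are RH-CONSEQUENCES whose RH binder
is a hypothesis of the discharged statement. bears_on: LADDER-RH B-C/B-P (COLUMN 6). WHAT THIS IS NOT: a discharge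
of printed statements of the corpus; nothing here bears on the truth of RH.

Discharges (cell rh-crit/dbl, nodes La05:T2.1(1), La05:T2.1(2), La05:L6.1(ii)):

* `Literature.NumberTheory.LFunctions.lagarias2005_thm_2_1_1_holds : lagarias2005_thm_2_1_1`
  (J. C. Lagarias, Acta Arith. 120 (2005) = arXiv:math/0601653, **Theorem 2.1 (1)**, arXiv p. 8): for `|h| ≥ ½`
  and every `0 ≤ θ < 2π`, all zeros of `A_{h,θ}` and `B_{h,θ}` lie on `Re s = ½`, are simple, and interlace;
* `Literature.NumberTheory.LFunctions.lagarias2005_thm_2_1_2_holds : lagarias2005_thm_2_1_2`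
  (**Theorem 2.1 (2)**): the same under RH for `0 < |h| < ½`;
* `Literature.NumberTheory.LFunctions.lagarias2005_lemma_6_1_ii_holds : lagarias2005_lemma_6_1_ii`
  (**Lemma 6.1 (ii)**, typed in `LagariasDifferencedXiSpacings.lean`): under RH, `E_h(z) = ξ(½ + h − iz)` is a
  de Branges structure function for every `h > 0` — Lemma 2.1 (2) (`lagarias2005_lemma_2_1_2`) transported by
  `lagarias2005_lemma_6_1_ii_iff`.

## The printed proof and how it is followed

Lagarias: Lemma 2.1 gives hypothesis (2.6) for `E_{h,θ}(s) = e^{iθ}ξ(s+h)`; Lemma 2.2 then puts the zeros of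
`A_{h,θ}`, `B_{h,θ}` on the critical line (first half, `lagarias2005_lemma_2_2_zeros`, proved in the statement
file) and makes them interlace via the phase `φ(t)` of `E(½+it) = |E|e^{iφ(t)}`: (2.7)–(2.8) say `|E|² φ′ ≥ 0`,
`φ` non-constant, hence strictly increasing, and `A = |E| cos φ`, `B = −|E| sin φ` on the line; simplicity: a
multiple zero would be a common zero of `A_{h,θ}` and `B_{h,θ}`, i.e. a zero `s₀ + h` of `ξ` with real part
`½ + h` — impossible for `|h| ≥ ½`, resp. under RH for `h ≠ 0`.

We follow this with ONE sharpening that the tree provides and that the multiplicity bookkeeping needs: for `E_h`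
the phase velocity is `φ_h′(t) = Re ξ′/ξ(½ + h + it)`, which is STRICTLY POSITIVE — unconditionally for
`½ + h ≥ 1` (`Lagarias1999Eq14.re_logDeriv_riemannXi_pos_of_one_le_re`, Lagarias 1999 (1.4)) and under RH for
`½ + h > ½` (`Lagarias1999_riemannHypothesis_iff_holds`, Lagarias 1999 (1.5)). With `W(t) := e^{iθ}ξ(½+it+h)`
(`A_{h,θ}(½+it) = Re W(t)`, `B_{h,θ}(½+it) = −Im W(t)`, `W′/W = i ξ′/ξ`):

1. *simplicity* (`allZerosSimple_diffXiArot_of_logDeriv_pos`, `…Brot…`): `A′_{h,θ}(½+it) = i Im(e^{iθ}ξ′)`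
   (`deriv_diffXiArot_critical`), so `A = A′ = 0` at `½+it` would make `e^{iθ}ξ` purely imaginary and
   `e^{iθ}ξ′` real there, i.e. `Re ξ′/ξ = 0` — Lagarias' "common zero" argument in infinitesimal form;
2. *strict alternation* (`exists_diffXiBrot_zero_btwn`, `exists_diffXiArot_zero_btwn`): between two zeros of
   `Re W` there is a zero of `Im W` and conversely — a LOCAL version of the phase argument that needs no global
   continuous argument: if `Im W` had no zero on `[x, y]` it would have constant sign, so `∓iW` would take values
   in the right half-plane, where the principal argument is continuous, differentiable along `W` with derivative
   `Im(W′/W) = Re ξ′/ξ > 0`, hence strictly increasing (`strictMonoOn_of_deriv_pos`) — yet equal to `0` at both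
   ends (`exists_re_eq_zero_btwn`);
3. *counting* (`critZeroCountOn_eq_card`, `critZerosInterlace_of_btwn`): with simple zeros `critZeroCountOn` is a
   cardinality, the zero ordinates in a bounded window are finite (isolated zeros of a non-zero entire function
   on the compact segment), and two finite sets of reals each of which strictly separates the other differ in
   size by at most one on every window `(t₁, t₂]`;
4. `h < 0` is reduced to `h > 0` by `A_{−h,θ} = A_{h,−θ}`, `B_{−h,θ} = −B_{h,−θ}` (`diffXiArot_neg`,
   `diffXiBrot_neg`), as Lagarias does ("without loss of generality … `h ≥ 0`"); the conclusion holds for every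
   real `θ` (the printed range `0 ≤ θ < 2π` is not used).

Everything is PROVED; no named fact is introduced.

## References

* [Lagarias2005] J. C. Lagarias, *Zero spacing distributions for differenced L-functions*, Acta Arith. 120
  (2005), no. 2, 159–184, doi:10.4064/aa120-2-4 = arXiv:math/0601653 — Theorem 2.1 and its proof, Lemma 2.2
  and its proof ((2.7)–(2.8)), Lemma 6.1, §2.
* [LagariasXiPositivity1999] J. C. Lagarias, *On a positivity property of the Riemann ξ-function*, Acta Arith.
  89 (1999), 217–234 — (1.4), (1.5) (tree: `LagariasXiPositivityEq14Proofs.lean`).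
-/

noncomputable section

open Complex Set
open scoped ComplexConjugate Real

namespace Literature.NumberTheory.LFunctions

open Filter Topology

/-! ## Generic tools (private plumbing) -/

/-- The zeros of an entire function which is not identically zero are finite in number on every compact set.
[folklore] -/
private theorem finite_inter_preimage_zero_of_isCompact {f : ℂ → ℂ} (hf : Differentiable ℂ f) {x : ℂ}
    (hx : f x ≠ 0) {K : Set ℂ} (hK : IsCompact K) : (K ∩ f ⁻¹' {0}).Finite := by
  have hcod : (f ⁻¹' {0})ᶜ ∈ Filter.codiscrete ℂ :=
    AnalyticOnNhd.preimage_zero_mem_codiscrete (fun z _ ↦ hf.analyticAt z) hx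
  obtain ⟨hclosed, hdisc⟩ := compl_mem_codiscrete_iff.1 hcod
  exact (hK.inter_right hclosed).finite (hdisc.mono Set.inter_subset_right)

/-- If strictly between any two points of `S` there is a point of `T`, then `#S ≤ #T + 1`. [folklore] -/
private theorem card_le_card_add_one_of_forall_exists_btwn {S T : Finset ℝ}
    (h : ∀ x ∈ S, ∀ y ∈ S, x < y → ∃ z ∈ T, x < z ∧ z < y) : S.card ≤ T.card + 1 := by
  -- strengthen: `#S ≤ #{z ∈ T | z < max S} + 1`, by induction on `S` inserting maxima
  suffices key : ∀ S : Finset ℝ, (∀ x ∈ S, ∀ y ∈ S, x < y → ∃ z ∈ T, x < z ∧ z < y) →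
      ∀ m ∈ S, (∀ x ∈ S, x ≤ m) → S.card ≤ (T.filter (· < m)).card + 1 by
    rcases S.eq_empty_or_nonempty with rfl | hne
    · simp
    · exact (key S h (S.max' hne) (S.max'_mem hne) (fun x hx ↦ S.le_max' x hx)).trans
        (by gcongr; exact Finset.filter_subset _ _)
  intro S
  induction S using Finset.induction_on_max with
  | empty => intro _ m hm; simp at hm
  | insert a S ha ih =>
    intro hS m hm hmax
    have hma : m = a := by
      have h1 := hmax a (Finset.mem_insert_self a S)
      rcases Finset.mem_insert.1 hm with rfl | hm'
      · rfl
      · exact absurd h1 (not_le.2 (ha m hm'))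
    subst hma
    have haS : m ∉ S := fun h' ↦ lt_irrefl _ (ha m h')
    rw [Finset.card_insert_of_notMem haS]
    rcases S.eq_empty_or_nonempty with rfl | hne
    · simp
    · set m' := S.max' hne with hm'
      have hm'S : m' ∈ S := S.max'_mem hne
      have hm'lt : m' < m := ha m' hm'S
      have hS' : ∀ x ∈ S, ∀ y ∈ S, x < y → ∃ z ∈ T, x < z ∧ z < y := fun x hx y hy hxy ↦
        hS x (Finset.mem_insert_of_mem hx) y (Finset.mem_insert_of_mem hy) hxy
      have ih' := ih hS' m' hm'S (fun x hx ↦ S.le_max' x hx)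
      obtain ⟨z, hzT, hz1, hz2⟩ := hS m' (Finset.mem_insert_of_mem hm'S) m (Finset.mem_insert_self _ _) hm'lt
      have hsub : insert z (T.filter (· < m')) ⊆ T.filter (· < m) := by
        intro w hw
        rcases Finset.mem_insert.1 hw with rfl | hw'
        · exact Finset.mem_filter.2 ⟨hzT, hz2⟩
        · obtain ⟨hwT, hwlt⟩ := Finset.mem_filter.1 hw'
          exact Finset.mem_filter.2 ⟨hwT, hwlt.trans hm'lt⟩
      have hz_notMem : z ∉ T.filter (· < m') := fun hz ↦ lt_irrefl _ ((Finset.mem_filter.1 hz).2.trans hz1)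
      have hcard := Finset.card_le_card hsub
      rw [Finset.card_insert_of_notMem hz_notMem] at hcard
      omega

/-- **No return of the argument.** If `V : ℝ → ℂ` is continuous on `[a,b]` with positive real part there, and
differentiable on `(a,b)` with `Im (V′/V) > 0`, then `arg V(a) < arg V(b)`. [folklore] -/
private theorem arg_lt_arg_of_im_div_pos {V V' : ℝ → ℂ} {a b : ℝ} (hab : a < b)
    (hc : ContinuousOn V (Set.Icc a b)) (hre : ∀ t ∈ Set.Icc a b, 0 < (V t).re)
    (hd : ∀ t ∈ Set.Ioo a b, HasDerivAt V (V' t) t) (hpos : ∀ t ∈ Set.Ioo a b, 0 < (V' t / V t).im) :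
    arg (V a) < arg (V b) := by
  have hslit : ∀ t ∈ Set.Icc a b, V t ∈ slitPlane := fun t ht ↦ Or.inl (hre t ht)
  have hcont : ContinuousOn (fun t ↦ arg (V t)) (Set.Icc a b) := fun t ht ↦
    (continuousAt_arg (hslit t ht)).comp_continuousWithinAt (hc t ht)
  have hderiv : ∀ t ∈ interior (Set.Icc a b), 0 < deriv (fun t ↦ arg (V t)) t := by
    rw [interior_Icc]
    intro t ht
    have h1 : HasDerivAt (fun t ↦ log (V t)) (V' t / V t) t :=
      (hd t ht).clog_real (hslit t (Set.Ioo_subset_Icc_self ht))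
    have h2 : HasDerivAt (fun t ↦ (log (V t)).im) ((V' t / V t).im) t := by
      have h2' := Complex.imCLM.hasFDerivAt.comp_hasDerivAt t h1
      simpa [Function.comp_def] using h2'
    have h3 : (fun t ↦ arg (V t)) = fun t ↦ (log (V t)).im := by
      funext t; rw [Complex.log_im]
    rw [h3, h2.deriv]
    exact hpos t ht
  exact strictMonoOn_of_deriv_pos (convex_Icc a b) hcont hderiv (Set.left_mem_Icc.2 hab.le)
    (Set.right_mem_Icc.2 hab.le) hab

/-- Between two "real" values of `W` (`Im W = 0`) there is a "purely imaginary" one (`Re W = 0`), when the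
argument of `W` increases along the path (`Im (W′/W) > 0`) and `W ≠ 0` — the local form of Lagarias' phase
argument (2.7)–(2.8). [cite: Lagarias2005, Lemma 2.2, proof, (2.7)–(2.8) (arXiv pp. 6–7; held text p0005)] -/
theorem exists_re_eq_zero_btwn {W W' : ℝ → ℂ} {x y : ℝ} (hxy : x < y)
    (hc : ContinuousOn W (Set.Icc x y)) (hne : ∀ t ∈ Set.Icc x y, W t ≠ 0)
    (hd : ∀ t ∈ Set.Ioo x y, HasDerivAt W (W' t) t) (hpos : ∀ t ∈ Set.Ioo x y, 0 < (W' t / W t).im)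
    (hx : (W x).im = 0) (hy : (W y).im = 0) : ∃ z ∈ Set.Ioo x y, (W z).re = 0 := by
  by_contra hcon
  push Not at hcon
  -- `Re W ≠ 0` on `[x, y]`
  have hre : ∀ t ∈ Set.Icc x y, (W t).re ≠ 0 := by
    intro t ht
    rcases Set.eq_endpoints_or_mem_Ioo_of_mem_Icc ht with rfl | rfl | ht'
    · intro h0; exact hne _ ht (Complex.ext h0 hx)
    · intro h0; exact hne _ ht (Complex.ext h0 hy)
    · exact hcon t ht'
  -- hence of constant sign (intermediate value theorem)
  have hcre : ContinuousOn (fun t ↦ (W t).re) (Set.Icc x y) := Complex.continuous_re.comp_continuousOn hc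
  have hsign : (∀ t ∈ Set.Icc x y, 0 < (W t).re) ∨ (∀ t ∈ Set.Icc x y, (W t).re < 0) := by
    rcases lt_or_gt_of_ne (hre x (Set.left_mem_Icc.2 hxy.le)) with hneg | hposx
    · refine Or.inr fun t ht ↦ ?_
      by_contra h'
      push Not at h'
      have h'' : 0 < (W t).re := lt_of_le_of_ne h' (hre t ht).symm
      have hsub : Set.Icc x t ⊆ Set.Icc x y := Set.Icc_subset_Icc le_rfl ht.2
      obtain ⟨c, hc1, hc2⟩ := intermediate_value_Icc ht.1 (hcre.mono hsub)
        (Set.mem_Icc.2 ⟨hneg.le, h''.le⟩)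
      exact hre c (hsub hc1) hc2
    · refine Or.inl fun t ht ↦ ?_
      by_contra h'
      push Not at h'
      have h'' : (W t).re < 0 := lt_of_le_of_ne h' (hre t ht)
      have hsub : Set.Icc x t ⊆ Set.Icc x y := Set.Icc_subset_Icc le_rfl ht.2
      obtain ⟨c, hc1, hc2⟩ := intermediate_value_Icc' ht.1 (hcre.mono hsub)
        (Set.mem_Icc.2 ⟨h''.le, hposx.le⟩)
      exact hre c (hsub hc1) hc2
  rcases hsign with hp | hn
  · -- `V = W`
    have key := arg_lt_arg_of_im_div_pos hxy hc hp hd hpos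
    have ha : arg (W x) = 0 := Complex.arg_eq_zero_iff.2 ⟨(hp x (Set.left_mem_Icc.2 hxy.le)).le, hx⟩
    have hb : arg (W y) = 0 := Complex.arg_eq_zero_iff.2 ⟨(hp y (Set.right_mem_Icc.2 hxy.le)).le, hy⟩
    rw [ha, hb] at key
    exact lt_irrefl _ key
  · -- `V = -W`
    have hc' : ContinuousOn (fun t ↦ -W t) (Set.Icc x y) := hc.neg
    have hp : ∀ t ∈ Set.Icc x y, 0 < (-W t).re := fun t ht ↦ by simp; linarith [hn t ht]
    have hd' : ∀ t ∈ Set.Ioo x y, HasDerivAt (fun t ↦ -W t) (-W' t) t := fun t ht ↦ (hd t ht).neg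
    have hpos' : ∀ t ∈ Set.Ioo x y, 0 < (-W' t / -W t).im := fun t ht ↦ by
      rw [neg_div_neg_eq]; exact hpos t ht
    have key := arg_lt_arg_of_im_div_pos hxy hc' hp hd' hpos'
    have ha : arg (-W x) = 0 :=
      Complex.arg_eq_zero_iff.2 ⟨(hp x (Set.left_mem_Icc.2 hxy.le)).le, by simp [hx]⟩
    have hb : arg (-W y) = 0 :=
      Complex.arg_eq_zero_iff.2 ⟨(hp y (Set.right_mem_Icc.2 hxy.le)).le, by simp [hy]⟩
    rw [ha, hb] at key
    exact lt_irrefl _ key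

/-! ## `E_{h,θ}` on the critical line: `W(t) = e^{iθ} ξ(½ + it + h)`

In comments: `p(t) = ½ + it + h`, `W(t) = e^{iθ} ξ(p(t)) = E_{h,θ}(½ + it)`, so that `A_{h,θ}(½+it) = Re W(t)`,
`B_{h,θ}(½+it) = −Im W(t)` (`diffXiArot_critical`, `diffXiBrot_critical`) and `W′/W = i ξ′/ξ(p(t))`. -/

/-- `Re (i w) = −Im w`. [folklore] -/
private theorem re_I_mul (w : ℂ) : (I * w).re = -w.im := by simp

/-- `Im (i w) = Re w`. [folklore] -/
private theorem im_I_mul (w : ℂ) : (I * w).im = w.re := by simp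

/-- `W′(t) = e^{iθ} ξ′(p(t)) · i`. [folklore] -/
private theorem hasDerivAt_rotXi_critLine (h θ t : ℝ) :
    HasDerivAt (fun t : ℝ ↦ cexp (θ * I) * riemannXi (1 / 2 + t * I + h))
      (cexp (θ * I) * (deriv riemannXi (1 / 2 + t * I + h) * I)) t := by
  have hp : HasDerivAt (fun t : ℝ ↦ (1 / 2 : ℂ) + t * I + h) I t := by
    have := (((hasDerivAt_id t).ofReal_comp).mul_const I |>.const_add (1 / 2 : ℂ)).add_const (h : ℂ)
    simpa using this
  have hξ : HasDerivAt riemannXi (deriv riemannXi (1 / 2 + t * I + h)) ((1 / 2 : ℂ) + t * I + h) :=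
    (differentiable_riemannXi _).hasDerivAt
  have := (hξ.comp t hp).const_mul (cexp (θ * I))
  simpa [Function.comp_def] using this

/-- `W` is continuous. [folklore] -/
private theorem continuous_rotXi_critLine (h θ : ℝ) :
    Continuous (fun t : ℝ ↦ cexp (θ * I) * riemannXi (1 / 2 + t * I + h)) :=
  continuous_iff_continuousAt.2 fun t ↦ (hasDerivAt_rotXi_critLine h θ t).continuousAt

/-- `Im (W′/W) = Re ξ′/ξ(p(t))`. [folklore] -/
private theorem im_rotXi_logDeriv (h θ t : ℝ) :
    (cexp (θ * I) * (deriv riemannXi (1 / 2 + t * I + h) * I) / (cexp (θ * I) * riemannXi (1 / 2 + t * I + h))).im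
      = (logDeriv riemannXi (1 / 2 + t * I + h)).re := by
  rw [mul_div_mul_left _ _ (Complex.exp_ne_zero _), logDeriv_apply, mul_div_right_comm, Complex.mul_I_im]

/-- Positivity of `Re ξ′/ξ` on the line `Re s = ½ + h` forces `ξ ≠ 0` there (Mathlib's `logDeriv` is `0` at a zero).
[folklore] -/
private theorem riemannXi_ne_zero_of_logDeriv_pos {h t : ℝ} (hpos : 0 < (logDeriv riemannXi (1 / 2 + t * I + h)).re) :
    riemannXi (1 / 2 + t * I + h) ≠ 0 := by
  intro h0
  rw [logDeriv_apply, h0, div_zero, Complex.zero_re] at hpos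
  exact lt_irrefl _ hpos

/-- `A_{h,θ}(½+it) = 0 ⟺ Re W(t) = 0`. [cite: Lagarias2005, Theorem 2.1, proof (arXiv p. 8; held text p0006)] -/
theorem diffXiArot_critical_eq_zero_iff (h θ t : ℝ) :
    diffXiArot h θ (1 / 2 + t * I) = 0 ↔ (cexp (θ * I) * riemannXi (1 / 2 + t * I + h)).re = 0 := by
  rw [diffXiArot_critical, Complex.ofReal_eq_zero]

/-- `B_{h,θ}(½+it) = 0 ⟺ Im W(t) = 0`. [cite: Lagarias2005, Theorem 2.1, proof (arXiv p. 8; held text p0006)] -/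
theorem diffXiBrot_critical_eq_zero_iff (h θ t : ℝ) :
    diffXiBrot h θ (1 / 2 + t * I) = 0 ↔ (cexp (θ * I) * riemannXi (1 / 2 + t * I + h)).im = 0 := by
  rw [diffXiBrot_critical, Complex.ofReal_eq_zero, neg_eq_zero]

/-- `A_{h,θ}` in exponential form: `A_{h,θ}(s) = ½ (e^{iθ} ξ(s+h) + e^{−iθ} ξ(s−h))` (Euler in the printed
`cos`/`sin` formula). [cite: Lagarias2005, §2, display before Theorem 2.1 (arXiv pp. 7–8; held text p0006)] -/
theorem diffXiArot_eq_exp (h θ : ℝ) (s : ℂ) :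
    diffXiArot h θ s = (cexp (θ * I) * riemannXi (s + h) + cexp (-(θ * I)) * riemannXi (s - h)) / 2 := by
  rw [diffXiArot_apply, diffXiA_apply, diffXiB_apply, show -((θ : ℂ) * I) = (-θ : ℂ) * I by ring,
    Complex.exp_mul_I, Complex.exp_mul_I, Complex.cos_neg, Complex.sin_neg, ← Complex.ofReal_cos,
    ← Complex.ofReal_sin]
  ring

/-- `B_{h,θ}` in exponential form: `B_{h,θ}(s) = (i/2) (e^{iθ} ξ(s+h) − e^{−iθ} ξ(s−h))`.
[cite: Lagarias2005, §2, display before Theorem 2.1 (arXiv pp. 7–8; held text p0006)] -/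
theorem diffXiBrot_eq_exp (h θ : ℝ) (s : ℂ) :
    diffXiBrot h θ s = I * (cexp (θ * I) * riemannXi (s + h) - cexp (-(θ * I)) * riemannXi (s - h)) / 2 := by
  rw [diffXiBrot_apply, diffXiA_apply, diffXiB_apply, show -((θ : ℂ) * I) = (-θ : ℂ) * I by ring,
    Complex.exp_mul_I, Complex.exp_mul_I, Complex.cos_neg, Complex.sin_neg, ← Complex.ofReal_cos,
    ← Complex.ofReal_sin]
  linear_combination (-(Real.sin θ : ℂ) * (riemannXi (s + h) + riemannXi (s - h)) / 2) * I_sq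

/-- `A′_{h,θ}(s) = ½ (e^{iθ} ξ′(s+h) + e^{−iθ} ξ′(s−h))`. [folklore] -/
private theorem hasDerivAt_diffXiArot (h θ : ℝ) (s : ℂ) :
    HasDerivAt (diffXiArot h θ)
      ((cexp (θ * I) * deriv riemannXi (s + h) + cexp (-(θ * I)) * deriv riemannXi (s - h)) / 2) s := by
  have hA : diffXiArot h θ =
      fun s ↦ (cexp (θ * I) * riemannXi (s + h) + cexp (-(θ * I)) * riemannXi (s - h)) / 2 :=
    funext (diffXiArot_eq_exp h θ)
  rw [hA]
  have h1 : HasDerivAt (fun s ↦ riemannXi (s + h)) (deriv riemannXi (s + h)) s :=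
    HasDerivAt.comp_add_const s h (differentiable_riemannXi _).hasDerivAt
  have h2 : HasDerivAt (fun s ↦ riemannXi (s - h)) (deriv riemannXi (s - h)) s :=
    HasDerivAt.comp_sub_const s h (differentiable_riemannXi _).hasDerivAt
  exact ((h1.const_mul _).add (h2.const_mul _)).div_const 2

/-- `B′_{h,θ}(s) = (i/2) (e^{iθ} ξ′(s+h) − e^{−iθ} ξ′(s−h))`. [folklore] -/
private theorem hasDerivAt_diffXiBrot (h θ : ℝ) (s : ℂ) :
    HasDerivAt (diffXiBrot h θ)
      (I * (cexp (θ * I) * deriv riemannXi (s + h) - cexp (-(θ * I)) * deriv riemannXi (s - h)) / 2) s := by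
  have hB : diffXiBrot h θ =
      fun s ↦ I * (cexp (θ * I) * riemannXi (s + h) - cexp (-(θ * I)) * riemannXi (s - h)) / 2 :=
    funext (diffXiBrot_eq_exp h θ)
  rw [hB]
  have h1 : HasDerivAt (fun s ↦ riemannXi (s + h)) (deriv riemannXi (s + h)) s :=
    HasDerivAt.comp_add_const s h (differentiable_riemannXi _).hasDerivAt
  have h2 : HasDerivAt (fun s ↦ riemannXi (s - h)) (deriv riemannXi (s - h)) s :=
    HasDerivAt.comp_sub_const s h (differentiable_riemannXi _).hasDerivAt
  exact (((h1.const_mul _).sub (h2.const_mul _)).const_mul I).div_const 2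

/-- On the critical line the second term is minus the conjugate of the first:
`e^{−iθ} ξ′(½ + it − h) = −conj (e^{iθ} ξ′(½ + it + h))`. [folklore] -/
private theorem rotXi_deriv_reflect (h θ t : ℝ) :
    cexp (-(θ * I)) * deriv riemannXi (1 / 2 + t * I - h) =
      -conj (cexp (θ * I) * deriv riemannXi (1 / 2 + t * I + h)) := by
  have e1 : (1 / 2 : ℂ) + t * I - h = 1 - conj (1 / 2 + t * I + h) := by
    simp only [map_add, map_mul, Complex.conj_ofReal, Complex.conj_I, map_div₀, map_one, map_ofNat]
    ring
  have e2 : cexp (-(θ * I)) = conj (cexp (θ * I)) := by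
    rw [← Complex.exp_conj]; simp
  rw [e1, deriv_riemannXi_one_sub, deriv_riemannXi_conj, e2, map_mul]
  ring

/-- `A′_{h,θ}(½+it) = i · Im(e^{iθ} ξ′(p(t)))`. [cite: Lagarias2005, Theorem 2.1, proof (arXiv p. 8; held text p0006)] -/
theorem deriv_diffXiArot_critical (h θ t : ℝ) :
    deriv (diffXiArot h θ) (1 / 2 + t * I) =
      ((cexp (θ * I) * deriv riemannXi (1 / 2 + t * I + h)).im : ℂ) * I := by
  rw [(hasDerivAt_diffXiArot h θ _).deriv, rotXi_deriv_reflect, ← sub_eq_add_neg, Complex.sub_conj]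
  push_cast
  ring

/-- `B′_{h,θ}(½+it) = i · Re(e^{iθ} ξ′(p(t)))`. [cite: Lagarias2005, Theorem 2.1, proof (arXiv p. 8; held text p0006)] -/
theorem deriv_diffXiBrot_critical (h θ t : ℝ) :
    deriv (diffXiBrot h θ) (1 / 2 + t * I) =
      I * ((cexp (θ * I) * deriv riemannXi (1 / 2 + t * I + h)).re : ℂ) := by
  rw [(hasDerivAt_diffXiBrot h θ _).deriv, rotXi_deriv_reflect, sub_neg_eq_add, Complex.add_conj]
  push_cast
  ring

/-- A point on the critical line is `½ + i·(Im s)`. [folklore] -/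
private theorem eq_critLine_of_re {s : ℂ} (hs : s.re = 1 / 2) : s = 1 / 2 + (s.im : ℝ) * I :=
  Complex.ext (by simp [hs]) (by simp)

section Master

variable {h θ : ℝ}

/-- All zeros of `A_{h,θ}`, `B_{h,θ}` lie on the critical line, from (2.6) for `E_{h,θ}` (Lemma 2.2, first half).
[cite: Lagarias2005, Theorem 2.1, proof (arXiv p. 8; held text p0006)] -/
theorem allZerosOnCriticalLine_diffXi_of_critHB
    (hHB : ∀ s : ℂ, 1 / 2 < s.re → ‖diffXiErot h θ (1 - conj s)‖ < ‖diffXiErot h θ s‖) :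
    AllZerosOnCriticalLine (diffXiArot h θ) ∧ AllZerosOnCriticalLine (diffXiBrot h θ) := by
  obtain ⟨hA, hB⟩ := lagarias2005_lemma_2_2_zeros hHB
  refine ⟨fun s hs ↦ hA s ?_, fun s hs ↦ hB s ?_⟩
  · rwa [← diffXiArot_eq_critRePart]
  · rwa [← diffXiBrot_eq_critImPart]

/-- **Simplicity of the zeros of `A_{h,θ}`** from (2.6) and `Re ξ′/ξ > 0` on `Re s = ½ + h`: a zero `s₀ = ½ + it`
with `A′(s₀) = 0` would make `e^{iθ}ξ(p(t))` purely imaginary and `e^{iθ}ξ′(p(t))` real, so `Re ξ′/ξ(p(t)) = 0` —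
Lagarias' "common zero of `A_{h,θ}` and `B_{h,θ}`" argument in infinitesimal form.
[cite: Lagarias2005, Theorem 2.1, proof (arXiv p. 8; held text p0006)] -/
theorem allZerosSimple_diffXiArot_of_logDeriv_pos
    (hHB : ∀ s : ℂ, 1 / 2 < s.re → ‖diffXiErot h θ (1 - conj s)‖ < ‖diffXiErot h θ s‖)
    (hpos : ∀ t : ℝ, 0 < (logDeriv riemannXi (1 / 2 + t * I + h)).re) : AllZerosSimple (diffXiArot h θ) := by
  intro s h0 hd
  have hre : s.re = 1 / 2 := (allZerosOnCriticalLine_diffXi_of_critHB hHB).1 s h0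
  set t : ℝ := s.im with ht
  have hs : s = 1 / 2 + t * I := eq_critLine_of_re hre
  rw [hs] at h0 hd
  rw [diffXiArot_critical_eq_zero_iff] at h0
  rw [deriv_diffXiArot_critical, mul_eq_zero, Complex.ofReal_eq_zero] at hd
  have hd' : (cexp (θ * I) * deriv riemannXi (1 / 2 + t * I + h)).im = 0 := by
    rcases hd with hd | hd
    · exact hd
    · exact absurd hd I_ne_zero
  have hp := hpos t
  have key : logDeriv riemannXi (1 / 2 + t * I + h) =
      (cexp (θ * I) * deriv riemannXi (1 / 2 + t * I + h)) / (cexp (θ * I) * riemannXi (1 / 2 + t * I + h)) := by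
    rw [mul_div_mul_left _ _ (Complex.exp_ne_zero _), logDeriv_apply]
  rw [key, Complex.div_re, h0, hd'] at hp
  simp at hp

/-- **Simplicity of the zeros of `B_{h,θ}`** (same argument with real and imaginary parts exchanged).
[cite: Lagarias2005, Theorem 2.1, proof (arXiv p. 8; held text p0006)] -/
theorem allZerosSimple_diffXiBrot_of_logDeriv_pos
    (hHB : ∀ s : ℂ, 1 / 2 < s.re → ‖diffXiErot h θ (1 - conj s)‖ < ‖diffXiErot h θ s‖)
    (hpos : ∀ t : ℝ, 0 < (logDeriv riemannXi (1 / 2 + t * I + h)).re) : AllZerosSimple (diffXiBrot h θ) := by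
  intro s h0 hd
  have hre : s.re = 1 / 2 := (allZerosOnCriticalLine_diffXi_of_critHB hHB).2 s h0
  set t : ℝ := s.im with ht
  have hs : s = 1 / 2 + t * I := eq_critLine_of_re hre
  rw [hs] at h0 hd
  rw [diffXiBrot_critical_eq_zero_iff] at h0
  rw [deriv_diffXiBrot_critical, mul_eq_zero, Complex.ofReal_eq_zero] at hd
  have hd' : (cexp (θ * I) * deriv riemannXi (1 / 2 + t * I + h)).re = 0 := by
    rcases hd with hd | hd
    · exact absurd hd I_ne_zero
    · exact hd
  have hp := hpos t
  have key : logDeriv riemannXi (1 / 2 + t * I + h) =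
      (cexp (θ * I) * deriv riemannXi (1 / 2 + t * I + h)) / (cexp (θ * I) * riemannXi (1 / 2 + t * I + h)) := by
    rw [mul_div_mul_left _ _ (Complex.exp_ne_zero _), logDeriv_apply]
  rw [key, Complex.div_re, h0, hd'] at hp
  simp at hp

/-- **Strict alternation, I**: strictly between two zeros of `A_{h,θ}` on the critical line lies a zero of
`B_{h,θ}` (the phase of `e^{iθ}ξ(½+it+h)` increases strictly: velocity `Re ξ′/ξ > 0`).
[cite: Lagarias2005, Lemma 2.2, proof, (2.7)–(2.8) (arXiv pp. 6–7; held text p0005)] -/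
theorem exists_diffXiBrot_zero_btwn (hpos : ∀ t : ℝ, 0 < (logDeriv riemannXi (1 / 2 + t * I + h)).re)
    {x y : ℝ} (hxy : x < y) (hx : diffXiArot h θ (1 / 2 + x * I) = 0)
    (hy : diffXiArot h θ (1 / 2 + y * I) = 0) :
    ∃ z ∈ Set.Ioo x y, diffXiBrot h θ (1 / 2 + z * I) = 0 := by
  rw [diffXiArot_critical_eq_zero_iff] at hx hy
  have hW := hasDerivAt_rotXi_critLine h θ
  obtain ⟨z, hz, hz0⟩ := exists_re_eq_zero_btwn (x := x) (y := y)
    (W := fun t ↦ I * (cexp (θ * I) * riemannXi (1 / 2 + t * I + h)))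
    (W' := fun t ↦ I * (cexp (θ * I) * (deriv riemannXi (1 / 2 + t * I + h) * I))) hxy
    ((continuous_const.mul (continuous_rotXi_critLine h θ)).continuousOn)
    (fun t _ ↦ mul_ne_zero I_ne_zero
      (mul_ne_zero (Complex.exp_ne_zero _) (riemannXi_ne_zero_of_logDeriv_pos (hpos t))))
    (fun t _ ↦ (hW t).const_mul I)
    (fun t _ ↦ by
      rw [mul_div_mul_left _ _ I_ne_zero, im_rotXi_logDeriv h θ t]
      exact hpos t)
    (by rw [im_I_mul]; exact hx) (by rw [im_I_mul]; exact hy)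
  refine ⟨z, hz, ?_⟩
  rw [diffXiBrot_critical_eq_zero_iff]
  rw [re_I_mul, neg_eq_zero] at hz0
  exact hz0

/-- **Strict alternation, II**: strictly between two zeros of `B_{h,θ}` on the critical line lies a zero of
`A_{h,θ}`. [cite: Lagarias2005, Lemma 2.2, proof, (2.7)–(2.8) (arXiv pp. 6–7; held text p0005)] -/
theorem exists_diffXiArot_zero_btwn (hpos : ∀ t : ℝ, 0 < (logDeriv riemannXi (1 / 2 + t * I + h)).re)
    {x y : ℝ} (hxy : x < y) (hx : diffXiBrot h θ (1 / 2 + x * I) = 0)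
    (hy : diffXiBrot h θ (1 / 2 + y * I) = 0) :
    ∃ z ∈ Set.Ioo x y, diffXiArot h θ (1 / 2 + z * I) = 0 := by
  rw [diffXiBrot_critical_eq_zero_iff] at hx hy
  have hW := hasDerivAt_rotXi_critLine h θ
  obtain ⟨z, hz, hz0⟩ := exists_re_eq_zero_btwn (x := x) (y := y)
    (W := fun t ↦ cexp (θ * I) * riemannXi (1 / 2 + t * I + h))
    (W' := fun t ↦ cexp (θ * I) * (deriv riemannXi (1 / 2 + t * I + h) * I)) hxy
    (continuous_rotXi_critLine h θ).continuousOn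
    (fun t _ ↦ mul_ne_zero (Complex.exp_ne_zero _) (riemannXi_ne_zero_of_logDeriv_pos (hpos t)))
    (fun t _ ↦ hW t)
    (fun t _ ↦ by
      rw [im_rotXi_logDeriv h θ t]
      exact hpos t)
    hx hy
  exact ⟨z, hz, (diffXiArot_critical_eq_zero_iff h θ z).2 hz0⟩

end Master

/-! ## Counting simple zeros on the critical line -/

/-- For an entire `F` all of whose zeros are simple, `critZeroCountOn F S` is the number of zero ordinates in `S`
(when finite). [cite: Lagarias2005, §2 Remark (1) (arXiv p. 6; held text p0005)] -/
theorem critZeroCountOn_eq_card {F : ℂ → ℂ} (hF : Differentiable ℂ F) (hsimple : AllZerosSimple F)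
    {S : Set ℝ} (hfin : (critZeroOrdinates F ∩ S).Finite) : critZeroCountOn F S = hfin.toFinset.card := by
  unfold critZeroCountOn
  rw [finsum_mem_eq_finite_toFinset_sum _ hfin, Finset.card_eq_sum_ones]
  refine Finset.sum_congr rfl fun t ht ↦ ?_
  obtain ⟨h0, -⟩ := hfin.mem_toFinset.1 ht
  rw [mem_critZeroOrdinates] at h0
  have h1 : analyticOrderAt F (1 / 2 + t * I) = 1 :=
    (hF.analyticAt _).analyticOrderAt_eq_one_of_zero_deriv_ne_zero h0 (hsimple _ h0)
  rw [analyticOrderNatAt, h1]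
  rfl

/-- The parametrisation `t ↦ ½ + it` of the critical line is injective. [folklore] -/
private theorem critLine_injective : Function.Injective (fun t : ℝ ↦ (1 / 2 : ℂ) + t * I) := by
  intro t₁ t₂ h
  have := congrArg Complex.im h
  simpa using this

/-- For an entire `F`, not identically zero, the zero ordinates in a bounded height window are finite.
[folklore] -/
private theorem finite_critZeroOrdinates_inter {F : ℂ → ℂ} (hF : Differentiable ℂ F) {x : ℂ} (hx : F x ≠ 0)
    {S : Set ℝ} {a b : ℝ} (hS : S ⊆ Set.Icc a b) : (critZeroOrdinates F ∩ S).Finite := by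
  have hK : IsCompact ((fun t : ℝ ↦ (1 / 2 : ℂ) + t * I) '' Set.Icc a b) := isCompact_Icc.image (by fun_prop)
  have hfin := finite_inter_preimage_zero_of_isCompact hF hx hK
  refine (Set.Finite.of_finite_image (hfin.subset ?_) critLine_injective.injOn).subset
    (Set.inter_subset_inter_right _ hS)
  rintro _ ⟨t, ⟨ht0, ht⟩, rfl⟩
  exact ⟨⟨t, ht, rfl⟩, ht0⟩

/-- **Interlacing from strict alternation**: if all zeros of `F` and `G` are simple, `F`, `G` entire and not
identically zero, and strictly between two critical-line zeros of either lies one of the other, then the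
critical-line zeros of `F` and `G` interlace in the counting sense (`CritZerosInterlace`).
[cite: Lagarias2005, §2 Remark (1) (arXiv p. 6; held text p0005)] -/
theorem critZerosInterlace_of_btwn {F G : ℂ → ℂ} (hF : Differentiable ℂ F) (hG : Differentiable ℂ G)
    {xF xG : ℂ} (hxF : F xF ≠ 0) (hxG : G xG ≠ 0) (hsF : AllZerosSimple F) (hsG : AllZerosSimple G)
    (hFG : ∀ x y : ℝ, x < y → F (1 / 2 + x * I) = 0 → F (1 / 2 + y * I) = 0 →
      ∃ z ∈ Set.Ioo x y, G (1 / 2 + z * I) = 0)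
    (hGF : ∀ x y : ℝ, x < y → G (1 / 2 + x * I) = 0 → G (1 / 2 + y * I) = 0 →
      ∃ z ∈ Set.Ioo x y, F (1 / 2 + z * I) = 0) :
    CritZerosInterlace F G := by
  intro t₁ t₂ _
  have hfinF : (critZeroOrdinates F ∩ Set.Ioc t₁ t₂).Finite :=
    finite_critZeroOrdinates_inter hF hxF Set.Ioc_subset_Icc_self
  have hfinG : (critZeroOrdinates G ∩ Set.Ioc t₁ t₂).Finite :=
    finite_critZeroOrdinates_inter hG hxG Set.Ioc_subset_Icc_self
  rw [critZeroCountOn_eq_card hF hsF hfinF, critZeroCountOn_eq_card hG hsG hfinG]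
  have h1 : hfinF.toFinset.card ≤ hfinG.toFinset.card + 1 := by
    refine card_le_card_add_one_of_forall_exists_btwn fun x hx y hy hxy ↦ ?_
    obtain ⟨hx0, hxI⟩ := hfinF.mem_toFinset.1 hx
    obtain ⟨hy0, hyI⟩ := hfinF.mem_toFinset.1 hy
    obtain ⟨z, hz, hz0⟩ := hFG x y hxy hx0 hy0
    exact ⟨z, hfinG.mem_toFinset.2 ⟨hz0, hxI.1.trans hz.1, hz.2.le.trans hyI.2⟩, hz.1, hz.2⟩
  have h2 : hfinG.toFinset.card ≤ hfinF.toFinset.card + 1 := by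
    refine card_le_card_add_one_of_forall_exists_btwn fun x hx y hy hxy ↦ ?_
    obtain ⟨hx0, hxI⟩ := hfinG.mem_toFinset.1 hx
    obtain ⟨hy0, hyI⟩ := hfinG.mem_toFinset.1 hy
    obtain ⟨z, hz, hz0⟩ := hGF x y hxy hx0 hy0
    exact ⟨z, hfinF.mem_toFinset.2 ⟨hz0, hxI.1.trans hz.1, hz.2.le.trans hyI.2⟩, hz.1, hz.2⟩
  constructor <;> omega

section Master

variable {h θ : ℝ}

/-- **Theorem 2.1 for `E_{h,θ}`, from (2.6) and `Re ξ′/ξ > 0` on `Re s = ½ + h`**: all zeros of `A_{h,θ}` and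
`B_{h,θ}` lie on the critical line, are simple, and interlace. [cite: Lagarias2005, Theorem 2.1, proof (arXiv p. 8; held text p0006)] -/
theorem diffXi_zeroPattern_of_logDeriv_pos
    (hHB : ∀ s : ℂ, 1 / 2 < s.re → ‖diffXiErot h θ (1 - conj s)‖ < ‖diffXiErot h θ s‖)
    (hpos : ∀ t : ℝ, 0 < (logDeriv riemannXi (1 / 2 + t * I + h)).re) :
    AllZerosOnCriticalLine (diffXiArot h θ) ∧ AllZerosOnCriticalLine (diffXiBrot h θ) ∧
      AllZerosSimple (diffXiArot h θ) ∧ AllZerosSimple (diffXiBrot h θ) ∧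
        CritZerosInterlace (diffXiArot h θ) (diffXiBrot h θ) := by
  obtain ⟨hA, hB⟩ := allZerosOnCriticalLine_diffXi_of_critHB hHB
  have hsA := allZerosSimple_diffXiArot_of_logDeriv_pos hHB hpos
  have hsB := allZerosSimple_diffXiBrot_of_logDeriv_pos hHB hpos
  have hA1 : diffXiArot h θ 1 ≠ 0 := fun h0 ↦ by have := hA 1 h0; norm_num at this
  have hB1 : diffXiBrot h θ 1 ≠ 0 := fun h0 ↦ by have := hB 1 h0; norm_num at this
  exact ⟨hA, hB, hsA, hsB, critZerosInterlace_of_btwn (differentiable_diffXiArot h θ)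
    (differentiable_diffXiBrot h θ) hA1 hB1 hsA hsB (fun x y hxy hx hy ↦ exists_diffXiBrot_zero_btwn hpos hxy hx hy)
    (fun x y hxy hx hy ↦ exists_diffXiArot_zero_btwn hpos hxy hx hy)⟩

end Master

/-! ## The reduction `h ↦ −h` and the discharges -/

/-- `A_{−h,θ} = A_{h,−θ}` (from `A_{−h} = A_h`, `B_{−h} = −B_h`). [cite: Lagarias2005, §2 (arXiv pp. 4–5; held text p0004)] -/
theorem diffXiArot_neg (h θ : ℝ) : diffXiArot (-h) θ = diffXiArot h (-θ) := by
  funext s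
  simp only [diffXiArot_apply, diffXiA_neg, diffXiB_neg, Real.cos_neg, Real.sin_neg, Complex.ofReal_neg]
  ring

/-- `B_{−h,θ} = −B_{h,−θ}`. [cite: Lagarias2005, §2 (arXiv pp. 4–5; held text p0004)] -/
theorem diffXiBrot_neg (h θ : ℝ) : diffXiBrot (-h) θ = -diffXiBrot h (-θ) := by
  funext s
  simp only [diffXiBrot_apply, diffXiA_neg, diffXiB_neg, Real.cos_neg, Real.sin_neg, Complex.ofReal_neg,
    Pi.neg_apply]
  ring

/-- Negating a function preserves "all zeros on the critical line". [folklore] -/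
private theorem allZerosOnCriticalLine_neg {F : ℂ → ℂ} (hF : AllZerosOnCriticalLine F) :
    AllZerosOnCriticalLine (-F) := fun s hs ↦ hF s (by simpa using hs)

/-- Negating a function preserves "all zeros simple". [folklore] -/
private theorem allZerosSimple_neg {F : ℂ → ℂ} (hF : AllZerosSimple F) : AllZerosSimple (-F) := by
  intro s hs
  rw [deriv.neg]
  exact neg_ne_zero.2 (hF s (by simpa using hs))

/-- Negating a function does not change its critical-line zero counts. [folklore] -/
private theorem critZeroCountOn_neg (F : ℂ → ℂ) (S : Set ℝ) : critZeroCountOn (-F) S = critZeroCountOn F S := by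
  have h1 : critZeroOrdinates (-F) = critZeroOrdinates F := by
    ext t; simp [critZeroOrdinates]
  simp [critZeroCountOn, h1, analyticOrderNatAt, analyticOrderAt_neg]

/-- Negating the second function preserves interlacing. [folklore] -/
private theorem critZerosInterlace_neg_right {F G : ℂ → ℂ} (hFG : CritZerosInterlace F G) :
    CritZerosInterlace F (-G) := by
  intro t₁ t₂ ht
  rw [critZeroCountOn_neg]
  exact hFG t₁ t₂ ht

/-- `Re(½ + it + h) = ½ + h`. [folklore] -/
private theorem re_critLine_shift (h t : ℝ) : ((1 / 2 : ℂ) + t * I + h).re = 1 / 2 + h := by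
  simp

/-- The zero pattern of Theorem 2.1 for `(h, θ)`, for every `θ`, from (2.6) for `E_{|h|, θ′}` (all `θ′`) and the
phase velocity on `Re s = ½ + |h|` ("without loss of generality we need only consider `h ≥ 0`").
[cite: Lagarias2005, Theorem 2.1, proof (arXiv p. 8; held text p0006)] -/
private theorem diffXi_zeroPattern_of_abs {h : ℝ}
    (hHB : ∀ θ' : ℝ, ∀ s : ℂ, 1 / 2 < s.re → ‖diffXiErot |h| θ' (1 - conj s)‖ < ‖diffXiErot |h| θ' s‖)
    (hpos : ∀ t : ℝ, 0 < (logDeriv riemannXi (1 / 2 + t * I + |h|)).re) (θ : ℝ) :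
    AllZerosOnCriticalLine (diffXiArot h θ) ∧ AllZerosOnCriticalLine (diffXiBrot h θ) ∧
      AllZerosSimple (diffXiArot h θ) ∧ AllZerosSimple (diffXiBrot h θ) ∧
        CritZerosInterlace (diffXiArot h θ) (diffXiBrot h θ) := by
  rcases le_or_gt 0 h with h0 | h0
  · rw [abs_of_nonneg h0] at hHB hpos
    exact diffXi_zeroPattern_of_logDeriv_pos (hHB θ) hpos
  · rw [abs_of_neg h0] at hHB hpos
    obtain ⟨hA, hB, hsA, hsB, hI⟩ := diffXi_zeroPattern_of_logDeriv_pos (hHB (-θ)) hpos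
    have eA : diffXiArot h θ = diffXiArot (-h) (-θ) := by rw [diffXiArot_neg, neg_neg]
    have eB : diffXiBrot h θ = -diffXiBrot (-h) (-θ) := by rw [diffXiBrot_neg, neg_neg, neg_neg]
    rw [eA, eB]
    exact ⟨hA, allZerosOnCriticalLine_neg hB, hsA, allZerosSimple_neg hsB, critZerosInterlace_neg_right hI⟩

/-- **Lagarias 2005, Theorem 2.1 (1)** — discharge of `lagarias2005_thm_2_1_1` (RH-FREE): for `|h| ≥ ½` and every
`0 ≤ θ < 2π`, the zeros of `A_{h,θ}`, `B_{h,θ}` lie on the critical line, are simple, and interlace. Inputs: Lemma 2.1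
(1) (`lagarias2005_lemma_2_1_holds`, via `diffXiErot_critHB`), Lemma 2.2 first half, and — for the printed phase
argument (2.7)–(2.8) — the positivity `Re ξ′/ξ(s) > 0` for `Re s ≥ 1`
(`Lagarias1999Eq14.re_logDeriv_riemannXi_pos_of_one_le_re`), the velocity of the phase of `ξ(½ + h + it)`.
[cite: Lagarias2005, Theorem 2.1 (1) (arXiv p. 8; held text p0006 L25)] -/
theorem lagarias2005_thm_2_1_1_holds : lagarias2005_thm_2_1_1 := by
  intro h θ hh _ _
  refine diffXi_zeroPattern_of_abs (fun θ' ↦ diffXiErot_critHB hh θ') (fun t ↦ ?_) θ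
  exact Lagarias1999Eq14.re_logDeriv_riemannXi_pos_of_one_le_re (by rw [re_critLine_shift]; linarith)

/-- **Lagarias 2005, Theorem 2.1 (2)** — discharge of `lagarias2005_thm_2_1_2` (RH-CONSEQUENCE; the RH binder is the
hypothesis): under RH, for `0 < |h| < ½` and every `0 ≤ θ < 2π`, the same conclusion. Inputs: Lemma 2.1 (2)
(`lagarias2005_lemma_2_1_2`, via `diffXiErot_critHB_rh`) and `RH ⟹ Re ξ′/ξ(s) > 0` for `Re s > ½`
(`Lagarias1999_riemannHypothesis_iff_holds`). [cite: Lagarias2005, Theorem 2.1 (2) (arXiv p. 8; held text p0006 L25)] -/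
theorem lagarias2005_thm_2_1_2_holds : lagarias2005_thm_2_1_2 := by
  intro hRH h θ hh _ _ _
  have hh' : 0 < |h| := hh
  refine diffXi_zeroPattern_of_abs (fun θ' ↦ diffXiErot_critHB_rh hRH hh' θ') (fun t ↦ ?_) θ
  exact Lagarias1999_riemannHypothesis_iff_holds.1 hRH _ (by rw [re_critLine_shift]; linarith)

/-- **Lagarias 2005, Lemma 6.1 (ii)** — discharge of `lagarias2005_lemma_6_1_ii` (RH-CONSEQUENCE; typed in
`LagariasDifferencedXiSpacings.lean`): under RH, for every `h > 0`, `E_h(z) = ξ(½ + h − iz)` is a de Branges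
structure function — "a restatement of Lemma 2.1" (2), here `lagarias2005_lemma_2_1_2`, transported by the
proved equivalence `lagarias2005_lemma_6_1_ii_iff`. [cite: Lagarias2005, Lemma 6.1 (ii) (arXiv p. 18; held text p0011 L139)] -/
theorem lagarias2005_lemma_6_1_ii_holds : lagarias2005_lemma_6_1_ii :=
  lagarias2005_lemma_6_1_ii_iff.2 fun hRH _ hh _ hs ↦ lagarias2005_lemma_2_1_2 hRH hh hs

end Literature.NumberTheory.LFunctions
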